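import Summits.ResolutionOfSingularities.ResolutionOfSingularities.Theses.MaxContactCut
import Summits.ResolutionOfSingularities.ResolutionOfSingularities.Theorems.GenericPointCutClasses
import Summits.ResolutionOfSingularities.ResolutionOfSingularities.Theorems.MaxContactCutTauLadder
import HarnessLib

/-!
# MaxContactCutGenericPointCut — kernels of the decomp-res node «GenericPointCut» (lens-2 g7) BY NAME

Source HOME/decomp-res-lens-2/g7/GenericPointCut.lean (sha256 85d60215dc2b140d; critic `lean check` rc 0, 0 sorry,
`closes_engines` axioms standard), CRITIC-LEDGER row 49 (2026-08-30T07:15Z): CLEARED AS MAP + CONFINEMENT NODE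
(residual 0 · decision +2 · map +1).  The dim-4 core of the order axis in SEQUENCE form — MaxContactCut's `RungOne`
(29273, `E 2 → E 1`) — is cut by the CODIMENSION IN `Y` OF THE IMAGE OF THE TOP LOCUS: per marking `n ≥ 1`,
`SeqDimFour 1 n ⟺ RoundCodimTwo n ∧ RoundCodimThree n ∧ ClosedPointCore n` (EXACT, pure logic,
`GenericPointCutClasses.seq_iff_rounds`, p765617).  Pieces = asides of `Theses/MaxContactCut.lean` rev 10 over
`Theorems.GenericPointCutClasses`: `RoundCodimTwoAll` [KNOWN-MOD-PORT(M) · DECIDED = cheap theorem #10: Cutkosky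
2009 Rem. 6.2 = tree fact `Cutkosky2009_rem_6_2` at codimension-2 points, re-walked by the critic in order
currency], `RoundCodimThreePrincipalAll` [KNOWN-MOD-PORT(M) · DECIDED pending desk T-cjs-scope: CJS 2020 for
hypersurface data], `RoundCodimThreeAll` [UNDECIDED · «CP-sized» · credit 0 · desk T-codim3], `ClosedPointCoreAll`
[THE LOCATED RESIDUAL ≡ target modulo the rounds · score 0 · IDEA-NEEDED · INSTRUMENTABLE T-confine-1/2], and the
typed ENGINES `ExcellentThreefoldOrderReduction` [UNDECIDED, counted 0] /
`ExcellentThreefoldOrderReductionPrincipal` [KNOWN-MOD-PORT (M)] (asides).  The globalisation PORTS `GlobTwo n` /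
`GlobThree n` / `GlobThreePrincipal n` (COSTUME, counted 0) are HYPOTHESES of the kernels, never items.  Kernels
(all PROVED, 0 sorry): `e_one_iff_asides` (EXACT: `E 1` ⟺ the three families), `rungOne_of_asides` (29273 BY NAME),
`stepDimFour_of_asides` (28011 via the costume `SequenceToStepAll` 29274), `core_of_asides` (28544 via
`MaxContactCutTauLadder.stepPICoreDimFour_of_stepDimFour`), `pocket_of_asides` (all five booked dim-4 classes),
`pencil_of_asides` (the pocket 27135 modulo `OrderBound` / 28008), the engine ledger `roundCodimTwoAll_of_engine` /
`roundCodimThreeAll_of_engine` / `roundCodimThreePrincipalAll_of_engine` / `core_of_engines`, the sub-case kernels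
`roundCodimThreePrincipalAll_of_roundCodimThreeAll` / `enginePrincipal_of_engine`, the necessity kernels
`asides_of_e_one` (by letter, no port) and the honesty kernel `closedPointCoreAll_iff_e_one_of_rounds` (modulo the
two rounds the residual IS `E 1`: the cut RELOCATES the open problem to finitely many closed fibres), and the ladder
compatibility `e_one_of_ladder_and_asides`.  These `E`-form statements are in SEQUENCE form and are not
summit-implied — DECLARED attack pieces, as in `Theorems/MaxContactCutTauLadder` / `MaxContactCutForcedTowers`.  MAP
EDGE (critic): the located residual `ClosedPointCoreAll` is the EMBEDDED, FIXED-ORDER twin of DeepSandwich's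
`PointSandwichResolve` / `FibreBoundedResolve` (25833 / 26947) — order-lineage ≡ sandwich-lineage residual shape
(Temkin 2008 Prop. 2.3.4 transported).  Why this is novel (cell-relative): no other node grades the dim-4 core by
the codimension of the IMAGE point in the base, which is what lets the lower-dimensional transversal theories over
IMPERFECT residue fields (Cutkosky dim 2, CJS hypersurfaces) be spent BY NAME before the residual is named.
(Cutkosky2009 Thm. 6.1 / Rem. 6.2; CossartJannsenSaito2020 Thm. 1.4; Temkin2008 Prop. 2.3.4; CossartPiltant2019
Prop. 4.3/4.4.)
-/

namespace Summit.ResolutionOfSingularities.ResolutionOfSingularities.Theorems.MaxContactCutGenericPointCut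

open CategoryTheory AlgebraicGeometry
open Literature.AlgebraicGeometry.Resolution
open Summit.ResolutionOfSingularities.ResolutionOfSingularities.Theses
open Summit.ResolutionOfSingularities.ResolutionOfSingularities.Theorems
open WeakOrderReduction GenericPointCutClasses

/-! ## EXACTNESS at the family level: `E 1` ⟺ the three asides -/

/-- **EXACT**: `E 1` (weak order reduction for ALL dim-4 data, every marking) ⟺ `RoundCodimTwoAll ∧ RoundCodimThreeAll
∧ ClosedPointCoreAll` — pure logic over `seq_iff_rounds`. [folklore] -/
theorem e_one_iff_asides : E 1 ↔ MaxContactCut.RoundCodimTwoAll ∧ MaxContactCut.RoundCodimThreeAll ∧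
    MaxContactCut.ClosedPointCoreAll :=
  e_one_iff_families

/-- The three asides give `E 1`. [folklore] -/
theorem e_one_of_asides (h2 : MaxContactCut.RoundCodimTwoAll) (h3 : MaxContactCut.RoundCodimThreeAll)
    (hC : MaxContactCut.ClosedPointCoreAll) : E 1 :=
  e_one_iff_asides.mpr ⟨h2, h3, hC⟩

/-- NECESSITY by letter (no port): `E 1` gives each of the three asides. [folklore] -/
theorem asides_of_e_one (h : E 1) : MaxContactCut.RoundCodimTwoAll ∧ MaxContactCut.RoundCodimThreeAll ∧
    MaxContactCut.ClosedPointCoreAll :=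
  e_one_iff_asides.mp h

/-- HONESTY KERNEL at the family level: modulo the two rounds, the located residual IS `E 1` (the cut relocates, it
does not shrink, the open problem). [folklore] -/
theorem closedPointCoreAll_iff_e_one_of_rounds (h2 : MaxContactCut.RoundCodimTwoAll)
    (h3 : MaxContactCut.RoundCodimThreeAll) : MaxContactCut.ClosedPointCoreAll ↔ E 1 :=
  ⟨fun hC => e_one_of_asides h2 h3 hC, fun h => (asides_of_e_one h).2.2⟩

/-- The principal sub-round is a sub-case of the general second round (family level). [folklore] -/
theorem roundCodimThreePrincipalAll_of_roundCodimThreeAll (h : MaxContactCut.RoundCodimThreeAll) :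
    MaxContactCut.RoundCodimThreePrincipalAll :=
  fun n hn => roundCodimThreePrincipal_of_roundCodimThree (h n hn)

/-! ## Up the ladder BY NAME: RungOne (29273), StepDimFour (28011), the core (28544), the pocket (27135) -/

/-- The route item `MaxContactCut.RungOne` (stmt-29273, `E 2 → E 1`, the declared residual of TauLadder) from the
three asides. [folklore] -/
theorem rungOne_of_asides (h2 : MaxContactCut.RoundCodimTwoAll) (h3 : MaxContactCut.RoundCodimThreeAll)
    (hC : MaxContactCut.ClosedPointCoreAll) : MaxContactCut.RungOne :=
  fun _ => e_one_of_asides h2 h3 hC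

/-- The WHOLE dim-4 step `MaxContactCut.StepDimFour` (28011) from the asides and the ladder's costume step-glue
`MaxContactCut.SequenceToStepAll` (29274). [folklore] -/
theorem stepDimFour_of_asides (h2 : MaxContactCut.RoundCodimTwoAll) (h3 : MaxContactCut.RoundCodimThreeAll)
    (hC : MaxContactCut.ClosedPointCoreAll) (hS : MaxContactCut.SequenceToStepAll) : MaxContactCut.StepDimFour :=
  hS (e_one_of_asides h2 h3 hC)

/-- **DECIDING IMPLICATION of the node**: the located core `MaxContactCut.StepPICoreDimFour` (28544) BY NAME.
[folklore] -/
theorem core_of_asides (h2 : MaxContactCut.RoundCodimTwoAll) (h3 : MaxContactCut.RoundCodimThreeAll)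
    (hC : MaxContactCut.ClosedPointCoreAll) (hS : MaxContactCut.SequenceToStepAll) :
    MaxContactCut.StepPICoreDimFour :=
  MaxContactCutTauLadder.stepPICoreDimFour_of_stepDimFour (stepDimFour_of_asides h2 h3 hC hS)

/-- All five booked dim-4 classes of MaxContactCut BY NAME (28011, 28009, 28010, 28543, 28544). [folklore] -/
theorem pocket_of_asides (h2 : MaxContactCut.RoundCodimTwoAll) (h3 : MaxContactCut.RoundCodimThreeAll)
    (hC : MaxContactCut.ClosedPointCoreAll) (hS : MaxContactCut.SequenceToStepAll) :
    MaxContactCut.StepDimFour ∧ MaxContactCut.StepContactDimFour ∧ MaxContactCut.StepContactFreeDimFour ∧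
      MaxContactCut.StepCFHigherDimFour ∧ MaxContactCut.StepPICoreDimFour :=
  have hD : MaxContactCut.StepDimFour := stepDimFour_of_asides h2 h3 hC hS
  ⟨hD, MaxContactCutTauCut.stepContactDimFour_of_stepDimFour hD,
    MaxContactCutTauCut.stepContactFreeDimFour_of_stepDimFour hD,
    MaxContactCutTauLadder.stepCFHigherDimFour_of_stepDimFour hD,
    MaxContactCutTauLadder.stepPICoreDimFour_of_stepDimFour hD⟩

/-- The dim-4 pencil pocket `OrderCut.PencilResolveDimFour` (27135) BY NAME, modulo the OrderCut costumes `OrderBound`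
(28006) and the order-one base `LocalOrderOneResolveDimFour` (28008). [folklore] -/
theorem pencil_of_asides (hB : MaxContactCut.OrderBound) (h1 : MaxContactCut.LocalOrderOneResolveDimFour)
    (h2 : MaxContactCut.RoundCodimTwoAll) (h3 : MaxContactCut.RoundCodimThreeAll)
    (hC : MaxContactCut.ClosedPointCoreAll) (hS : MaxContactCut.SequenceToStepAll) : OrderCut.PencilResolveDimFour :=
  MaxContactCutTauLadder.pencilResolveDimFour_of_step hB h1 (stepDimFour_of_asides h2 h3 hC hS)

/-! ## The engine ledger: engines (asides, counted 0) + ports (hypotheses) ⟹ the rounds -/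

/-- The first round from Cutkosky's dim-2 fact (tree `Cutkosky2009_rem_6_2`) through the port `GlobTwo`. [folklore] -/
theorem roundCodimTwoAll_of_engine (e2 : Cutkosky2009_rem_6_2.{0}) (g2 : ∀ n : ℕ, 1 ≤ n → GlobTwo n) :
    MaxContactCut.RoundCodimTwoAll :=
  fun n hn => g2 n hn e2

/-- The second round from the dim-3 engine (aside `ExcellentThreefoldOrderReduction`) through the port `GlobThree`.
[folklore] -/
theorem roundCodimThreeAll_of_engine (e3 : MaxContactCut.ExcellentThreefoldOrderReduction)
    (g3 : ∀ n : ℕ, 1 ≤ n → GlobThree n) : MaxContactCut.RoundCodimThreeAll :=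
  fun n hn => g3 n hn e3

/-- The principal second round from the CJS engine (aside `ExcellentThreefoldOrderReductionPrincipal`) through the
port `GlobThreePrincipal`. [folklore] -/
theorem roundCodimThreePrincipalAll_of_engine (e3 : MaxContactCut.ExcellentThreefoldOrderReductionPrincipal)
    (g3 : ∀ n : ℕ, 1 ≤ n → GlobThreePrincipal n) : MaxContactCut.RoundCodimThreePrincipalAll :=
  fun n hn => g3 n hn e3

/-- The principal engine is a sub-case of the general engine (aside level). [folklore] -/
theorem enginePrincipal_of_engine (h : MaxContactCut.ExcellentThreefoldOrderReduction) :
    MaxContactCut.ExcellentThreefoldOrderReductionPrincipal :=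
  excellentThreefoldOrderReductionPrincipal_of h

/-- **DECIDING IMPLICATION FROM ENGINES**: Cutkosky's dim-2 fact (tree), the dim-3 engine (aside, UNDECIDED), the two
globalisation ports (costume hypotheses), the located residual and the ladder's step-glue give the core 28544 BY NAME.
[folklore] -/
theorem core_of_engines (e2 : Cutkosky2009_rem_6_2.{0}) (g2 : ∀ n : ℕ, 1 ≤ n → GlobTwo n)
    (e3 : MaxContactCut.ExcellentThreefoldOrderReduction) (g3 : ∀ n : ℕ, 1 ≤ n → GlobThree n)
    (hC : MaxContactCut.ClosedPointCoreAll) (hS : MaxContactCut.SequenceToStepAll) :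
    MaxContactCut.StepPICoreDimFour :=
  core_of_asides (roundCodimTwoAll_of_engine e2 g2) (roundCodimThreeAll_of_engine e3 g3) hC hS

/-! ## Compatibility with the τ-ladder (TauLadder, tree) -/

/-- Given lens-5's contact family and the rungs R4, R3, R2 (tree items), the node's asides replace exactly `RungOne`.
[folklore] -/
theorem e_one_of_ladder_and_asides (h5 : MaxContactCutExhaustion.ContactOrderSequenceDimFour)
    (r4 : MaxContactCut.RungFour) (r3 : MaxContactCut.RungThree) (r2 : MaxContactCut.RungTwo)
    (h2 : MaxContactCut.RoundCodimTwoAll) (h3 : MaxContactCut.RoundCodimThreeAll)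
    (hC : MaxContactCut.ClosedPointCoreAll) : E 1 :=
  MaxContactCutTauLadder.e_one_of_ladder h5 r4 r3 r2 (rungOne_of_asides h2 h3 hC)

/-- With `E 2` in hand (rungs above closed), `RungOne` ⟺ the located residual modulo the two rounds. [folklore] -/
theorem rungOne_iff_core_of_rounds (hE2 : E 2) (h2 : MaxContactCut.RoundCodimTwoAll)
    (h3 : MaxContactCut.RoundCodimThreeAll) : MaxContactCut.RungOne ↔ MaxContactCut.ClosedPointCoreAll :=
  ⟨fun h => (asides_of_e_one (h hE2)).2.2, fun hC => rungOne_of_asides h2 h3 hC⟩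

end Summit.ResolutionOfSingularities.ResolutionOfSingularities.Theorems.MaxContactCutGenericPointCut
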